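import Summits.BirchSwinnertonDyer.BirchSwinnertonDyer.Theorems.ClassRecordThreeEulerHalvesAtThreeCartanCoverPrintClausesDescentGeneral
import Literature.NumberTheory.Automorphic.EichlerShimuraWeightTwoSplitInjective
import Literature.NumberTheory.Automorphic.EichlerOrdersMatrixRat
import HarnessLib

/-!
# Eichler–Shimura surjectivity with the parabolic condition: `GL₂⁺(ℝ)`-transport, normal finite-index descent,
# and the group theory of `h Γ(M) h⁻¹`

Part 1 of 2 of the reduction of the print residue (ESᶜ-surj-split)
`Literature.NumberTheory.Automorphic.eichlerShimura_weightTwo_rePeriod_surjective_of_exists_not_isUnit` (surjectivity in Shimura's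
Thm. 8.4, `n = 0`, `Ψ = 1`, for `Γ = ι(O¹)`, `O` an order of a rational quaternion algebra `B ≅ M₂(ℚ)`) to the same surjectivity
for the principal congruence subgroups `Γ(M)` (part 2: `…EichlerShimuraSurjectiveCongruenceReduction`). Helper files of the BSD cell
`bsd-stepL` (crux `EulerHalvesAtThree`, node `CartanOnePlaceDegreeLawAtThree`, line `Cruxes/CartanOnePlaceDegreeLawAtThree/Lines/lattice.lean`).

ES-surj-par(`Γ`), for a subgroup `Γ ≤ GL₂(ℝ)`, is the statement written INLINE throughout (no definition is introduced)
`∀ z₀ u, (∀ γ δ, u (γ δ) = u γ + u δ) → (∀ γ, γ parabolic → u γ = 0) → ∃ F : CuspForm Γ 2, ∀ γ, CuspForm.rePeriod F z₀ γ = u γ`: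
every additive `u : Γ → ℝ` vanishing on the parabolic elements of `Γ` is the real period cochain `γ ↦ Re ∫_{z₀}^{γ z₀} F` of a
weight-two cusp form. Contents (all sorry-free):

* TRANSPORT `esSurjPar_conjAct_smul`: ES-surj-par passes from `Γ` to `g Γ g⁻¹` for `det g > 0` — realise the pulled-back cochain
  `γ ↦ u(g γ g⁻¹)` at the base point `g⁻¹ z₀` by `F′ ∈ S₂(Γ)` and take `F = F′ ∣[2] g⁻¹` (Mathlib `CuspForm.translate`);
  `∫_{z₀}^{g γ g⁻¹ z₀} F′ ∣[2] g⁻¹ = ∫_{g⁻¹ z₀}^{γ g⁻¹ z₀} F′` (`segmentIntegral_slash_eq`), and parabolicity is conjugation invariant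
  (`Matrix.GeneralLinearGroup.isParabolic_conj_iff`).
* DESCENT `esSurjPar_of_normal_finiteIndex`: for `Γ′ ⊴ Γ` of finite index with `Γ ⊆ {det = 1}`, ES-surj-par(`Γ′`) ⇒ ES-surj-par(`Γ`)
  — restrict `u` to `Γ′` (a parabolic element of `Γ′` is one of `Γ`), realise the restriction by `F₁ ∈ S₂(Γ′)` and AVERAGE `F₁` over
  `Γ/Γ′`. This is the cell's averaging argument (`CartanCoverPrintClausesDescentGeneral`: `exists_cuspForm_coe_eq_slash_inv`,
  `rePeriod_of_coe_eq_slash_inv`, `rePeriod_finset_sum`, `addCochain_conj`, `addCochain_pow`) re-run with the realisation hypothesis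
  for the ONE restricted cochain only (`esSurj_of_normal_finiteIndex_pointwise`); the cell's `esSurj_of_normal_finiteIndex` asks it
  for every additive `u₁` on `Γ′`, which is not available when `Γ′` has cusps.
* GROUP THEORY `conj_Gamma_le_normal_finiteIndex`: if every element of `Γ₀ ≤ GL₂(ℝ)` is `h t h⁻¹` with `t ∈ SL₂(ℤ)` and
  `h s h⁻¹ ∈ Γ₀` for all `s ∈ Γ(M)` (`M ≥ 1`), then `h Γ(M) h⁻¹ ≤ Γ₀` is NORMAL (`CongruenceSubgroup.Gamma_normal`) and of FINITE
  INDEX (`Γ₀ ≤ h SL₂(ℤ) h⁻¹`, `Subgroup.relIndex_pointwise_smul`, `Subgroup.relIndex_map_map_of_injective`,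
  `CongruenceSubgroup.instFiniteIndexGamma`); plus `exists_eq_one_add_nsmul_of_mem_Gamma` (`s ∈ Γ(M) ⇒ s = 1 + M k`, the extraction
  of Mathlib's `exists_Gamma_le_conj`), the double-cast lemma `map_intCast_map_ratCast`, and the SIGN FIX
  `exists_le_map_unitsConj_det_pos`: `O₀ ⊆ g₀ M₂(ℤ) g₀⁻¹ ⇒ O₀ ⊆ g M₂(ℤ) g⁻¹` with `det (u g) > 0` (`g = g₀` or `g₀·diag(-1,1)`,
  which normalises `M₂(ℤ)`: `map_unitsConj_matrixOrder_eq_of_mem`).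

References: [ShimuraIATAF1971] G. Shimura, Introduction to the Arithmetic Theory of Automorphic Functions (1971), §8.1
(8.1.2)–(8.1.3), Thm. 8.4 p. 234, Prop. 1.19, §1.6; [DiamondShurman2005] F. Diamond, J. Shurman, A First Course in Modular Forms
(2005), §1.2 (`Γ(N) ⊴ SL₂(ℤ)` of finite index), §5.1 (slash action). No summit statement is proved by this file; BSD is proved for no curve.
-/

set_option linter.dupNamespace false
set_option autoImplicit false

noncomputable section

open scoped MatrixGroups ModularForm Pointwise
open ConjAct

namespace Summit.BirchSwinnertonDyer.BirchSwinnertonDyer.Theorems.EichlerShimuraCongruence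

open Literature.NumberTheory.Automorphic
open Summit.BirchSwinnertonDyer.BirchSwinnertonDyer.Theorems.CartanCover.PrintClauses

/-! ## §1 ES-surjectivity with the parabolic condition: the predicate, `GL₂⁺(ℝ)`-transport, descent -/

/-! ES-surj-par(`Γ`) — the surjectivity half of Shimura's Thm. 8.4 (`n = 0`) for a subgroup `Γ ≤ GL₂(ℝ)` in the
form used by the residue `eichlerShimura_weightTwo_rePeriod_surjective`, written INLINE throughout (no definition):
`∀ z₀ u, (∀ γ δ, u (γ * δ) = u γ + u δ) → (∀ γ, γ parabolic → u γ = 0) → ∃ F : CuspForm Γ 2, ∀ γ, rePeriod F z₀ γ = u γ`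
— for every base point `z₀`, every additive `u : Γ → ℝ` vanishing on the parabolic elements of `Γ` is the real period
cochain `γ ↦ Re ∫_{z₀}^{γ z₀} F` of some weight-two cusp form `F` on `Γ`. -/

/-- `g γ g⁻¹ ∈ g Γ g⁻¹` for `γ ∈ Γ`. [folklore] -/
theorem conj_mem_conjAct_smul {Γ : Subgroup (GL (Fin 2) ℝ)} (g : GL (Fin 2) ℝ) {γ : GL (Fin 2) ℝ} (hγ : γ ∈ Γ) :
    g * γ * g⁻¹ ∈ toConjAct g • Γ := by
  rw [← toConjAct_smul]
  exact Subgroup.smul_mem_pointwise_smul _ _ _ hγ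

/-- Elements of `g Γ g⁻¹` are `g γ g⁻¹`, `γ ∈ Γ`. [folklore] -/
theorem exists_eq_conj_of_mem_conjAct_smul {Γ : Subgroup (GL (Fin 2) ℝ)} {g δ : GL (Fin 2) ℝ} (hδ : δ ∈ toConjAct g • Γ) :
    ∃ γ ∈ Γ, δ = g * γ * g⁻¹ := by
  obtain ⟨y, hy, hyδ⟩ := (Subgroup.mem_smul_pointwise_iff_exists δ _ _).mp hδ
  exact ⟨y, hy, by rw [← hyδ, toConjAct_smul]⟩

/-- **TRANSPORT.** ES-surj-par is carried from `Γ` to `g Γ g⁻¹` for `det g > 0`: realise the pulled-back cochain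
`γ ↦ u(g γ g⁻¹)` at the base point `g⁻¹ z₀` by `F′ ∈ S₂(Γ)` and take `F = F′ ∣[2] g⁻¹` (Mathlib `CuspForm.translate`);
`∫_{z₀}^{g γ g⁻¹ z₀} F′ ∣[2] g⁻¹ = ∫_{g⁻¹ z₀}^{γ g⁻¹ z₀} F′` (`segmentIntegral_slash_eq`), and parabolicity is conjugation
invariant. [cite: ShimuraIATAF1971, §8.1 (8.1.2)–(8.1.3) and Thm. 8.4 p. 234] -/
theorem esSurjPar_conjAct_smul {Γ : Subgroup (GL (Fin 2) ℝ)}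
    (hΓ : (∀ (z₀ : UpperHalfPlane) (u : ↥(Γ) → ℝ), (∀ γ δ : ↥(Γ), u (γ * δ) = u γ + u δ) →
      (∀ γ : ↥(Γ), (γ : GL (Fin 2) ℝ).IsParabolic → u γ = 0) →
      ∃ F : CuspForm (Γ) 2, ∀ γ : ↥(Γ), CuspForm.rePeriod F z₀ γ = u γ))
    {g : GL (Fin 2) ℝ} (hg : 0 < g.det.val) :
    (∀ (z₀ : UpperHalfPlane) (u : ↥(toConjAct g • Γ) → ℝ), (∀ γ δ : ↥(toConjAct g • Γ), u (γ * δ) = u γ + u δ) →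
      (∀ γ : ↥(toConjAct g • Γ), (γ : GL (Fin 2) ℝ).IsParabolic → u γ = 0) →
      ∃ F : CuspForm (toConjAct g • Γ) 2, ∀ γ : ↥(toConjAct g • Γ), CuspForm.rePeriod F z₀ γ = u γ) := by
  intro z₀ u hu hpar
  -- the pulled-back cochain on `Γ`
  set u' : Γ → ℝ := fun γ => u ⟨g * γ * g⁻¹, conj_mem_conjAct_smul g γ.2⟩ with hu'def
  have hu' : ∀ γ δ : Γ, u' (γ * δ) = u' γ + u' δ := by
    intro γ δ
    rw [hu'def]
    dsimp only
    rw [← hu]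
    congr 1
    apply Subtype.ext
    simp only [Subgroup.coe_mul]
    group
  have hpar' : ∀ γ : Γ, (γ : GL (Fin 2) ℝ).IsParabolic → u' γ = 0 := by
    intro γ hγ
    apply hpar
    dsimp only
    exact (Matrix.GeneralLinearGroup.isParabolic_conj_iff g (γ : GL (Fin 2) ℝ)).mpr hγ
  obtain ⟨F', hF'⟩ := hΓ (g⁻¹ • z₀) u' hu' hpar'
  -- the translated form `F' ∣[2] g⁻¹` on `g Γ g⁻¹`
  set G := CuspForm.translate F' g⁻¹ with hGdef
  have hlev : toConjAct g⁻¹⁻¹ • Γ = toConjAct g • Γ := by rw [inv_inv]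
  have hcoeG : (⇑G : UpperHalfPlane → ℂ) = (⇑F' : UpperHalfPlane → ℂ) ∣[(2 : ℤ)] g⁻¹ := rfl
  let F : CuspForm (toConjAct g • Γ) 2 :=
    { toFun := ⇑G
      slash_action_eq' := fun γ hγ => SlashInvariantForm.slash_action_eqn G γ (by rw [hlev]; exact hγ)
      holo' := G.holo'
      zero_at_cusps' := fun hc => G.zero_at_cusps' (by rw [hlev]; exact hc) }
  have hcoeF : (⇑F : UpperHalfPlane → ℂ) = (⇑F' : UpperHalfPlane → ℂ) ∣[(2 : ℤ)] g⁻¹ := rfl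
  have hdet' : 0 < (g⁻¹).det.val := by
    rw [map_inv, Units.val_inv_eq_inv_val]
    exact inv_pos.mpr hg
  refine ⟨F, fun δ => ?_⟩
  obtain ⟨γ, hγ, hδ⟩ := exists_eq_conj_of_mem_conjAct_smul δ.2
  rw [CuspForm.rePeriod_apply, hcoeF, segmentIntegral_slash_eq F' hdet']
  have e : g⁻¹ • (δ : GL (Fin 2) ℝ) • z₀ = γ • g⁻¹ • z₀ := by
    rw [hδ, smul_smul, smul_smul]
    congr 1
    group
  rw [e]
  have h1 := hF' ⟨γ, hγ⟩
  rw [CuspForm.rePeriod_apply] at h1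
  rw [h1, hu'def]
  dsimp only
  congr 1
  exact Subtype.ext hδ.symm

section Descent

variable {Γ' Γ : Subgroup (GL (Fin 2) ℝ)}

/-- **POINTWISE DESCENT ALONG A NORMAL SUBGROUP OF FINITE INDEX** (the hypothesis of
`CartanCover.PrintClauses.esSurj_of_normal_finiteIndex` weakened to the one cochain that is used): `Γ' ≤ Γ ≤ SL₂(ℝ)`,
`Γ'` normal of finite index in `Γ`, `u : Γ → ℝ` additive; if `u|Γ'` is the real period cochain of some `F₁ ∈ S₂(Γ')`
then `u` is the real period cochain of `[Γ:Γ']⁻¹ Σ_{c ∈ Γ∕Γ'} F₁ ∣[2] c̃⁻¹ ∈ S₂(Γ)`. The proof is that of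
`esSurj_of_normal_finiteIndex` verbatim (its public blocks `exists_cuspForm_coe_eq_slash_inv`, `rePeriod_of_coe_eq_slash_inv`,
`isCusp_of_isCusp_of_finiteIndex`, `coe_finset_sum`, `finset_sum_slash`, `rePeriod_finset_sum`, `addCochain_conj`,
`addCochain_pow`). [cite: ShimuraIATAF1971, Thm. 8.4 p. 234 and §8.1 (8.1.2)–(8.1.3)] -/
theorem esSurj_of_normal_finiteIndex_pointwise [Γ.HasDetOne] (hle : Γ' ≤ Γ) (hN : (Γ'.subgroupOf Γ).Normal)
    (hfi : (Γ'.subgroupOf Γ).FiniteIndex) (z₀ : UpperHalfPlane) (u : Γ → ℝ) (hu : ∀ γ δ : Γ, u (γ * δ) = u γ + u δ)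
    (h₁ : ∃ F₁ : CuspForm Γ' 2, ∀ γ : Γ', CuspForm.rePeriod F₁ z₀ γ = u ⟨γ, hle γ.2⟩) :
    ∃ F : CuspForm Γ 2, ∀ γ : Γ, CuspForm.rePeriod F z₀ γ = u γ := by
  classical
  set Q := Γ ⧸ Γ'.subgroupOf Γ with hQdef
  haveI : Finite Q := Subgroup.finite_quotient_of_finiteIndex
  letI : Fintype Q := Fintype.ofFinite Q
  obtain ⟨F₁, hF₁⟩ := h₁
  -- translates by representatives
  have hT : ∀ c : Q, ∃ F : CuspForm Γ' 2, ⇑F = ⇑F₁ ∣[(2 : ℤ)] ((c.out : Γ) : GL (Fin 2) ℝ)⁻¹ :=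
    fun c => exists_cuspForm_coe_eq_slash_inv hle hN F₁ (c.out : Γ).2
  choose T hT using hT
  set G : CuspForm Γ' 2 := ∑ c : Q, T c with hGdef
  have hGcoe : ⇑G = ∑ c : Q, (⇑F₁ ∣[(2 : ℤ)] ((c.out : Γ) : GL (Fin 2) ℝ)⁻¹) := by
    rw [hGdef, coe_finset_sum]
    exact Finset.sum_congr rfl fun c _ => hT c
  -- `Γ`-invariance of `G`
  have hGinv : ∀ g ∈ Γ, (⇑G) ∣[(2 : ℤ)] g = ⇑G := by
    intro g hg
    rw [hGcoe, finset_sum_slash]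
    have hterm : ∀ c : Q, (⇑F₁ ∣[(2 : ℤ)] ((c.out : Γ) : GL (Fin 2) ℝ)⁻¹) ∣[(2 : ℤ)] g =
        ⇑F₁ ∣[(2 : ℤ)] ((((⟨g, hg⟩ : Γ)⁻¹ • c).out : Γ) : GL (Fin 2) ℝ)⁻¹ := by
      intro c
      rw [← SlashAction.slash_mul]
      set c' : Q := (⟨g, hg⟩ : Γ)⁻¹ • c with hc'
      have h1 : (QuotientGroup.mk ((⟨g, hg⟩ : Γ)⁻¹ * c.out) : Q) = c' := by
        rw [hc']
        conv_rhs => rw [← QuotientGroup.out_eq' c]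
        rfl
      have h2 : ((⟨g, hg⟩ : Γ)⁻¹ * c.out)⁻¹ * c'.out ∈ Γ'.subgroupOf Γ := by
        rw [← QuotientGroup.eq, h1, QuotientGroup.out_eq']
      rw [Subgroup.mem_subgroupOf] at h2
      have h3 : ((c.out : Γ) : GL (Fin 2) ℝ)⁻¹ * g =
          ((((⟨g, hg⟩ : Γ)⁻¹ * c.out)⁻¹ * c'.out : Γ) : GL (Fin 2) ℝ) * ((c'.out : Γ) : GL (Fin 2) ℝ)⁻¹ := by
        simp only [Subgroup.coe_mul, Subgroup.coe_inv, mul_inv_rev, inv_inv, mul_assoc, mul_inv_cancel, mul_one]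
      rw [h3, SlashAction.slash_mul, SlashInvariantForm.slash_action_eqn F₁ _ h2]
    simp_rw [hterm]
    exact Fintype.sum_equiv (MulAction.toPerm ((⟨g, hg⟩ : Γ)⁻¹)) _ _ fun c => rfl
  -- `G` as a cusp form on `Γ`
  let Gup : CuspForm Γ 2 :=
    { toFun := ⇑G
      slash_action_eq' := fun g hg => hGinv g hg
      holo' := G.holo'
      zero_at_cusps' := fun hc => G.zero_at_cusps' (isCusp_of_isCusp_of_finiteIndex hfi hc) }
  -- periods of `G` on `Γ'`: `N · u`
  set N : ℕ := Fintype.card Q with hNdef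
  have hNpos : 0 < N := Fintype.card_pos
  have havg : ∀ γ : Γ', CuspForm.rePeriod G z₀ γ = N * u ⟨γ, hle γ.2⟩ := by
    intro γ
    rw [hGdef, rePeriod_finset_sum]
    have hterm : ∀ c : Q, CuspForm.rePeriod (T c) z₀ γ = u ⟨γ, hle γ.2⟩ := by
      intro c
      rw [rePeriod_of_coe_eq_slash_inv hle hN F₁ (T c) (c.out : Γ).2 (hT c) z₀ γ, hF₁]
      have h := addCochain_conj hu (c.out : Γ) ⟨γ, hle γ.2⟩
      convert h using 2
      exact Subtype.ext (by simp [mul_assoc])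
    simp_rw [hterm]
    rw [Finset.sum_const, Finset.card_univ, nsmul_eq_mul]
  -- the normalised lift
  refine ⟨(N : ℝ)⁻¹ • Gup, fun γ => ?_⟩
  rw [CuspForm.rePeriod_smul]
  have hidx : (Γ'.subgroupOf Γ).index = N := by rw [hNdef, Subgroup.index_eq_card, Nat.card_eq_fintype_card]
  have hγN : ((γ ^ N : Γ) : GL (Fin 2) ℝ) ∈ Γ' := by
    have h := (Γ'.subgroupOf Γ).pow_index_mem γ
    rw [Subgroup.mem_subgroupOf, hidx] at h
    exact h
  have hadd : ∀ a b : Γ, CuspForm.rePeriod Gup z₀ (a * b) = CuspForm.rePeriod Gup z₀ a + CuspForm.rePeriod Gup z₀ b :=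
    CuspForm.rePeriod_mul _ z₀
  have hpow := addCochain_pow hadd γ N
  have hper : CuspForm.rePeriod Gup z₀ (γ ^ N) = N * (N * u γ) := by
    have h1 : CuspForm.rePeriod Gup z₀ (γ ^ N) = CuspForm.rePeriod G z₀ ⟨((γ ^ N : Γ) : GL (Fin 2) ℝ), hγN⟩ := rfl
    rw [h1, havg]
    congr 1
    have h2 := addCochain_pow hu γ N
    convert h2 using 2
  have hNne : (N : ℝ) ≠ 0 := by exact_mod_cast hNpos.ne'
  have h3 : (N : ℝ) * CuspForm.rePeriod Gup z₀ γ = N * (N * u γ) := by rw [← hpow, hper]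
  have h4 : CuspForm.rePeriod Gup z₀ γ = N * u γ := mul_left_cancel₀ hNne h3
  rw [h4, ← mul_assoc, inv_mul_cancel₀ hNne, one_mul]

/-- **DESCENT OF ES-surj-par.** `Γ' ≤ Γ ≤ SL₂(ℝ)`, `Γ'` normal of finite index in `Γ`: ES-surj-par(`Γ'`) implies
ES-surj-par(`Γ`) — the restriction of a parabolic-null additive cochain is parabolic-null (same matrices), so it is
realised on `Γ'`, and the pointwise descent lifts it. [cite: ShimuraIATAF1971, Thm. 8.4 p. 234 and §8.1 (8.1.2)–(8.1.3)] -/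
theorem esSurjPar_of_normal_finiteIndex [Γ.HasDetOne] (hle : Γ' ≤ Γ) (hN : (Γ'.subgroupOf Γ).Normal)
    (hfi : (Γ'.subgroupOf Γ).FiniteIndex)
    (h : (∀ (z₀ : UpperHalfPlane) (u : ↥(Γ') → ℝ), (∀ γ δ : ↥(Γ'), u (γ * δ) = u γ + u δ) →
      (∀ γ : ↥(Γ'), (γ : GL (Fin 2) ℝ).IsParabolic → u γ = 0) →
      ∃ F : CuspForm (Γ') 2, ∀ γ : ↥(Γ'), CuspForm.rePeriod F z₀ γ = u γ)) :
    (∀ (z₀ : UpperHalfPlane) (u : ↥(Γ) → ℝ), (∀ γ δ : ↥(Γ), u (γ * δ) = u γ + u δ) →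
      (∀ γ : ↥(Γ), (γ : GL (Fin 2) ℝ).IsParabolic → u γ = 0) →
      ∃ F : CuspForm (Γ) 2, ∀ γ : ↥(Γ), CuspForm.rePeriod F z₀ γ = u γ) := by
  intro z₀ u hu hpar
  refine esSurj_of_normal_finiteIndex_pointwise hle hN hfi z₀ u hu ?_
  exact h z₀ (fun γ => u ⟨γ, hle γ.2⟩) (fun γ δ => hu ⟨γ, hle γ.2⟩ ⟨δ, hle δ.2⟩)
    (fun γ hγ => hpar ⟨γ, hle γ.2⟩ hγ)

end Descent

/-! ## §1b Group theory of `h Γ(M) h⁻¹`; the sign fix `g ↦ g·diag(-1,1)` in `GL₂(ℚ)` -/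

section GroupTheory

/-- Elements of `Γ(M)` are `1 + M • k` with `k` integral (the extraction in Mathlib's `exists_Gamma_le_conj`). [folklore] -/
theorem exists_eq_one_add_nsmul_of_mem_Gamma {M : ℕ} {s : SL(2, ℤ)} (hs : s ∈ CongruenceSubgroup.Gamma M) :
    ∃ k : Matrix (Fin 2) (Fin 2) ℤ, (s : Matrix (Fin 2) (Fin 2) ℤ) = 1 + M • k := by
  have hs' : (s : Matrix (Fin 2) (Fin 2) ℤ).map (Int.cast : ℤ → ZMod M) = 1 := by
    have h1 := congr_arg (fun x : SL(2, ZMod M) => (x : Matrix (Fin 2) (Fin 2) (ZMod M)))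
      (CongruenceSubgroup.Gamma_mem'.mp hs)
    simpa [RingHom.mapMatrix_apply] using h1
  refine ⟨Matrix.of fun i j ↦ ((s : Matrix (Fin 2) (Fin 2) ℤ) - 1) i j / M, ?_⟩
  rw [← sub_eq_iff_eq_add']
  ext i j
  simp_rw [Matrix.smul_apply, Matrix.of_apply, nsmul_eq_mul]
  refine (Int.mul_ediv_cancel_of_dvd ?_).symm
  rw [← Matrix.map_one Int.cast (by simp) (by simp), ← sub_eq_zero, ← Matrix.map_sub _ (by simp)] at hs'
  simpa only [Matrix.zero_apply, Matrix.map_apply, ZMod.intCast_zmod_eq_zero_iff_dvd] using! congr_fun₂ hs' i j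

/-- Double cast of an integral matrix: `((Y : M₂(ℚ)) : M₂(ℝ)) = (mapGL-style) Y.map (algebraMap ℤ ℝ)`. [folklore] -/
theorem map_intCast_map_ratCast (Y : Matrix (Fin 2) (Fin 2) ℤ) :
    (Y.map (Int.cast : ℤ → ℚ)).map (Rat.castHom ℝ) = Y.map (algebraMap ℤ ℝ) := by
  ext i j
  simp [Matrix.map_apply]

/-- From the dictionary: `h Γ(M) h⁻¹ ≤ ι(O¹)`, NORMAL, of FINITE INDEX. [cite: ShimuraIATAF1971, §9.2 p. 246; Prop. 1.19] -/
theorem conj_Gamma_le_normal_finiteIndex {Γ₀ : Subgroup (GL (Fin 2) ℝ)} {h : GL (Fin 2) ℝ} {M : ℕ} (hM : 0 < M)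
    (hrep : ∀ γ ∈ Γ₀, ∃ t : SL(2, ℤ), γ = h * Matrix.SpecialLinearGroup.mapGL ℝ t * h⁻¹)
    (hmem : ∀ s ∈ CongruenceSubgroup.Gamma M, h * Matrix.SpecialLinearGroup.mapGL ℝ s * h⁻¹ ∈ Γ₀) :
    toConjAct h • (CongruenceSubgroup.Gamma M).map (Matrix.SpecialLinearGroup.mapGL ℝ) ≤ Γ₀ ∧
      ((toConjAct h • (CongruenceSubgroup.Gamma M).map (Matrix.SpecialLinearGroup.mapGL ℝ)).subgroupOf Γ₀).Normal ∧
      ((toConjAct h • (CongruenceSubgroup.Gamma M).map (Matrix.SpecialLinearGroup.mapGL ℝ)).subgroupOf Γ₀).FiniteIndex := by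
  haveI : NeZero M := ⟨hM.ne'⟩
  have hle : toConjAct h • (CongruenceSubgroup.Gamma M).map (Matrix.SpecialLinearGroup.mapGL ℝ) ≤ Γ₀ := by
    intro δ hδ
    obtain ⟨y, hy, rfl⟩ := exists_eq_conj_of_mem_conjAct_smul hδ
    obtain ⟨s, hs, rfl⟩ := Subgroup.mem_map.mp hy
    exact hmem s hs
  refine ⟨hle, ⟨fun δ hδ γ₀ => ?_⟩, ?_⟩
  · rw [Subgroup.mem_subgroupOf] at hδ ⊢
    obtain ⟨y, hy, hyδ⟩ := exists_eq_conj_of_mem_conjAct_smul hδ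
    obtain ⟨s, hs, rfl⟩ := Subgroup.mem_map.mp hy
    obtain ⟨t, ht⟩ := hrep γ₀ γ₀.2
    have hts : t * s * t⁻¹ ∈ CongruenceSubgroup.Gamma M := (CongruenceSubgroup.Gamma_normal M).conj_mem s hs t
    have key : ((γ₀ * δ * γ₀⁻¹ : Γ₀) : GL (Fin 2) ℝ) = h * Matrix.SpecialLinearGroup.mapGL ℝ (t * s * t⁻¹) * h⁻¹ := by
      rw [Subgroup.coe_mul, Subgroup.coe_mul, Subgroup.coe_inv, hyδ, ht, map_mul, map_mul, map_inv]
      group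
    rw [key]
    exact conj_mem_conjAct_smul h (Subgroup.mem_map_of_mem _ hts)
  · -- finite index: compare with `h SL₂(ℤ) h⁻¹ ⊇ Γ₀`
    have hΓ₀le : Γ₀ ≤ toConjAct h • ((⊤ : Subgroup SL(2, ℤ)).map (Matrix.SpecialLinearGroup.mapGL ℝ)) := by
      intro γ hγ
      obtain ⟨t, rfl⟩ := hrep γ hγ
      exact conj_mem_conjAct_smul h (Subgroup.mem_map_of_mem _ (Subgroup.mem_top t))
    have hrel : (toConjAct h • (CongruenceSubgroup.Gamma M).map (Matrix.SpecialLinearGroup.mapGL ℝ)).relIndex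
        (toConjAct h • ((⊤ : Subgroup SL(2, ℤ)).map (Matrix.SpecialLinearGroup.mapGL ℝ))) ≠ 0 := by
      rw [Subgroup.relIndex_pointwise_smul,
        Subgroup.relIndex_map_map_of_injective _ _ Matrix.SpecialLinearGroup.mapGL_injective,
        Subgroup.relIndex_top_right]
      exact Subgroup.FiniteIndex.index_ne_zero
    have hrel' : (toConjAct h • (CongruenceSubgroup.Gamma M).map (Matrix.SpecialLinearGroup.mapGL ℝ)).relIndex Γ₀ ≠ 0 :=
      fun h0 => hrel (Subgroup.relIndex_eq_zero_of_le_right hΓ₀le h0)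
    exact ⟨hrel'⟩

/-- The unit `diag(-1, 1) ∈ GL₂(ℚ)`: integral with integral inverse and determinant `-1`. [folklore] -/
theorem exists_units_diag_neg_one :
    ∃ j : (Matrix (Fin 2) (Fin 2) ℚ)ˣ, (j : Matrix (Fin 2) (Fin 2) ℚ).det = -1 ∧
      (j : Matrix (Fin 2) (Fin 2) ℚ) ∈ (matrixOrder ℤ ℚ : Submodule ℤ (Matrix (Fin 2) (Fin 2) ℚ)) ∧
      ((j⁻¹ : (Matrix (Fin 2) (Fin 2) ℚ)ˣ) : Matrix (Fin 2) (Fin 2) ℚ) ∈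
        (matrixOrder ℤ ℚ : Submodule ℤ (Matrix (Fin 2) (Fin 2) ℚ)) := by
  have hdet : (!![(-1 : ℤ), 0; 0, 1] : Matrix (Fin 2) (Fin 2) ℤ).det = -1 := by
    rw [Matrix.det_fin_two_of]; ring
  obtain ⟨j, hj, hj1, hj2⟩ := exists_units_coe_eq_map_intCast (!![(-1 : ℤ), 0; 0, 1]) (by rw [hdet]; exact isUnit_one.neg)
  refine ⟨j, ?_, hj1, hj2⟩
  rw [hj, ← Int.cast_det, hdet]
  push_cast
  ring

/-- **SIGN FIX.** If `φ(O) ⊆ g₀ M₂(ℤ) g₀⁻¹` then also `φ(O) ⊆ g M₂(ℤ) g⁻¹` for a `g` with `det (u g) > 0` — take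
`g = g₀` or `g = g₀ · diag(-1, 1)` (`diag(-1,1)` normalises `M₂(ℤ)`). [folklore] -/
theorem exists_le_map_unitsConj_det_pos (u : GL (Fin 2) ℝ) {O₀ : Submodule ℤ (Matrix (Fin 2) (Fin 2) ℚ)}
    {g₀ : (Matrix (Fin 2) (Fin 2) ℚ)ˣ}
    (hg₀ : O₀ ≤ (matrixOrder ℤ ℚ : Submodule ℤ (Matrix (Fin 2) (Fin 2) ℚ)).map
      (unitsConj g₀ : Matrix (Fin 2) (Fin 2) ℚ →ₗ[ℤ] Matrix (Fin 2) (Fin 2) ℚ)) :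
    ∃ g : (Matrix (Fin 2) (Fin 2) ℚ)ˣ,
      O₀ ≤ (matrixOrder ℤ ℚ : Submodule ℤ (Matrix (Fin 2) (Fin 2) ℚ)).map
        (unitsConj g : Matrix (Fin 2) (Fin 2) ℚ →ₗ[ℤ] Matrix (Fin 2) (Fin 2) ℚ) ∧
      0 < (u * Matrix.GeneralLinearGroup.map (Rat.castHom ℝ) g).det.val := by
  by_cases hpos : 0 < (u * Matrix.GeneralLinearGroup.map (Rat.castHom ℝ) g₀).det.val
  · exact ⟨g₀, hg₀, hpos⟩
  obtain ⟨j, hjdet, hj1, hj2⟩ := exists_units_diag_neg_one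
  refine ⟨g₀ * j, ?_, ?_⟩
  · rw [map_unitsConj_mul, map_unitsConj_matrixOrder_eq_of_mem j hj1 hj2]
    exact hg₀
  · have hne : (u * Matrix.GeneralLinearGroup.map (Rat.castHom ℝ) g₀).det.val ≠ 0 :=
      (u * Matrix.GeneralLinearGroup.map (Rat.castHom ℝ) g₀).det.ne_zero
    have hneg : (u * Matrix.GeneralLinearGroup.map (Rat.castHom ℝ) g₀).det.val < 0 :=
      lt_of_le_of_ne (not_lt.mp hpos) hne
    have hj' : (Matrix.GeneralLinearGroup.map (Rat.castHom ℝ) j).det.val = -1 := by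
      rw [Matrix.GeneralLinearGroup.val_det_apply]
      change ((j : Matrix (Fin 2) (Fin 2) ℚ).map (Rat.castHom ℝ)).det = -1
      rw [← RingHom.mapMatrix_apply, ← RingHom.map_det, hjdet, map_neg, map_one]
    rw [map_mul (Matrix.GeneralLinearGroup.map (Rat.castHom ℝ)) g₀ j, ← mul_assoc, map_mul, Units.val_mul, hj',
      mul_neg_one]
    linarith

end GroupTheory

end Summit.BirchSwinnertonDyer.BirchSwinnertonDyer.Theorems.EichlerShimuraCongruence

end
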